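import Summits.FinalStateConjecture.FinalStateConjecture.Theorems.ClusterCompletenessOmegaLimitMultiKerrTranslateCompactness
import Literature.Geometry.Lorentzian.SpacetimeChartDeviationTransfer
import HarnessLib

/-!
# Route ClusterCompleteness · crux `OmegaLimitMultiKerr` — the `Cᵏ_loc` ω-limit set of a tame
# field is sequentially compact

Structure lemma for the crux stmt-FinalStateConjecture-14664 (`ClusterCompleteness.OmegaLimitMultiKerr`),
line `Sketch`. The line reads the recurrence clause of the generic ω-limit dichotomy as "the
reference multi-Kerr configuration is an ω-LIMIT POINT of the late-time translates
`x ↦ h (x + T n • e)` of a chart field `h`" (`C^{k+1}` on an open domain `O ⊆ E` invariant under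
translation by the Killing direction `e`), convergence being `Cᵏ_loc`:
`supCkENorm K k (h (· + T n • e) − g) → 0` on every compact `K ⊆ O` along times `T n → +∞`.

**Theorem (`exists_omegaLimit_subseq_of_omegaLimits`).** If `h` is TAME — on every compact
`K ⊆ O` its derivatives of order `≤ k + 1` are bounded at all late translates `z + t • e`, `t ≥ a` —
then every sequence `gs m` of `Cᵏ` ω-limits of `h` has a subsequence converging in `Cᵏ_loc` to an
ω-limit `g` of `h`: the ω-limit set is sequentially compact. This is the compactness clause of
Hale 1980, Ch. I, §8, Thm. 8.1 (ω-limit sets of precompact orbits are nonempty, compact, invariant)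
in the `Cᵏ_loc` translation flow.

Proof: DIAGONAL + Arzelà–Ascoli. Along the monotone compact exhaustion `⋃ i ≤ m, Kx i` of `O`
choose times `τ m ≥ m` with `‖h (· + τ m • e) − gs m‖_{Cᵏ(⋃ i ≤ m, Kx i)} ≤ 1/m`; the `Cᵏ`
Arzelà–Ascoli theorem for translates (`exists_strictMono_tendsto_supCkENorm_translate_sub`) gives a
subsequence `φ` and a `Cᵏ` field `g` with `h (· + τ (φ m) • e) → g` in `Cᵏ_loc`, whence
`gs (φ m) → g` by the triangle inequality for `supCkENorm`.
-/

-- every `Summit.FinalStateConjecture.FinalStateConjecture.…` name repeats the summit = sub-problem segment (D-0017 layout)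
set_option linter.dupNamespace false

noncomputable section

open Set Filter Topology Function
open scoped ContDiff Topology ENNReal

namespace Summit.FinalStateConjecture.FinalStateConjecture.Theorems.ClusterCompleteness

open Literature.Geometry.Lorentzian

/-- Swapping the two terms of a difference does not change its `Cᵏ` sup norm
(`Dᵐ (-f) = -Dᵐ f` unconditionally for Mathlib's `iteratedFDeriv`). [folklore] -/
private theorem supCkENorm_sub_comm {F G : Type*} [NormedAddCommGroup F] [NormedSpace ℝ F]
    [NormedAddCommGroup G] [NormedSpace ℝ G] (S : Set F) (k : ℕ) (f g : F → G) :
    supCkENorm S k (fun x ↦ f x - g x) = supCkENorm S k (fun x ↦ g x - f x) := by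
  have hfg : (fun x ↦ f x - g x) = -fun x ↦ g x - f x := by
    funext x
    simp only [Pi.neg_apply, neg_sub]
  simp only [supCkENorm, hfg, iteratedFDeriv_neg_apply, enorm_neg]

/-- **The `Cᵏ_loc` ω-limit set of a tame field is sequentially compact** (compactness clause of
Hale 1980, Ch. I, §8, Thm. 8.1, for the translation flow `h ↦ h (· + t • e)` in the `Cᵏ_loc`
topology). Let `O ⊆ E` be open and invariant under `x ↦ x + s • e`, exhausted by the compact sets
`Kx j`; let `h` be `C^{k+1}` on `O` and tame (on each compact `K ⊆ O` the derivatives of order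
`≤ k + 1` of `h` are bounded at all translates `z + t • e`, `z ∈ K`, `t ≥ a`); and let `gs m` be
`Cᵏ` fields on `O` each of which is an ω-limit of `h`
(`supCkENorm K k (h (· + T n • e) − gs m) → 0` on compacts along some `T n → +∞`). Then along a
subsequence `φ` the `gs (φ m)` converge in `Cᵏ` on every compact subset of `O` to a `Cᵏ` field `g`
which is again an ω-limit of `h`. Diagonal argument over the exhaustion plus the `Cᵏ`
Arzelà–Ascoli theorem for translates `exists_strictMono_tendsto_supCkENorm_translate_sub`. Stated
in closed form (registered structure stub of the crux stmt-FinalStateConjecture-14664).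
[cite: Hale1980, Ch. I §8 Thm. 8.1] -/
theorem exists_omegaLimit_subseq_of_omegaLimits :
    ∀ {E : Type*} [NormedAddCommGroup E] [NormedSpace ℝ E] [FiniteDimensional ℝ E]
      {W : Type*} [NormedAddCommGroup W] [NormedSpace ℝ W] [FiniteDimensional ℝ W]
      {O : Set E} {e : E}, IsOpen O → (∀ x ∈ O, ∀ s : ℝ, x + s • e ∈ O) →
      ∀ (Kx : ℕ → Set E), (∀ j, IsCompact (Kx j)) → (∀ j, Kx j ⊆ O) →
      (∀ K ⊆ O, IsCompact K → ∃ j, K ⊆ Kx j) →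
      ∀ {k : ℕ} {h : E → W}, ContDiffOn ℝ (k + 1) h O →
      (∀ K ⊆ O, IsCompact K → ∃ Λ a : ℝ, ∀ t : ℝ, a ≤ t → ∀ i, i ≤ k + 1 → ∀ z ∈ K,
        ‖iteratedFDeriv ℝ i h (z + t • e)‖ ≤ Λ) →
      ∀ {gs : ℕ → E → W}, (∀ m, ContDiffOn ℝ k (gs m) O) →
      (∀ m, ∃ T : ℕ → ℝ, Tendsto T atTop atTop ∧ ∀ K ⊆ O, IsCompact K →
        Tendsto (fun n ↦ supCkENorm K k (fun x ↦ h (x + T n • e) - gs m x)) atTop (𝓝 0)) →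
      ∃ (g : E → W) (φ : ℕ → ℕ), StrictMono φ ∧ ContDiffOn ℝ k g O ∧
        (∃ T : ℕ → ℝ, Tendsto T atTop atTop ∧ ∀ K ⊆ O, IsCompact K →
          Tendsto (fun n ↦ supCkENorm K k (fun x ↦ h (x + T n • e) - g x)) atTop (𝓝 0)) ∧
        ∀ K ⊆ O, IsCompact K →
          Tendsto (fun m ↦ supCkENorm K k (fun x ↦ gs (φ m) x - g x)) atTop (𝓝 0) := by
  intro E _ _ _ W _ _ _ O e hO hOe Kx hKc hKO hcov k h hh htame gs hgs hω
  -- (1) the monotone compact exhaustion `K' m = ⋃ i ≤ m, Kx i` of `O`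
  set K' : ℕ → Set E := Set.accumulate Kx with hK'def
  have hK'c : ∀ m, IsCompact (K' m) := isCompact_accumulate hKc
  have hK'O : ∀ m, K' m ⊆ O := fun m ↦ iUnion₂_subset fun i _ ↦ hKO i
  have hK'cov : ∀ K ⊆ O, IsCompact K → ∀ᶠ m in atTop, K ⊆ K' m := by
    intro K hKO' hK
    obtain ⟨j, hj⟩ := hcov K hKO' hK
    exact eventually_atTop.2
      ⟨j, fun m hm ↦ hj.trans (subset_accumulate.trans (accumulate_subset_accumulate hm))⟩
  -- (2) diagonal choice of times `τ m ≥ m` with `‖h (· + τ m • e) - gs m‖_{Cᵏ(K' m)} ≤ 1/m`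
  have hchoice : ∀ m : ℕ, ∃ τ : ℝ, (m : ℝ) ≤ τ ∧
      supCkENorm (K' m) k (fun x ↦ h (x + τ • e) - gs m x) ≤ (m : ℝ≥0∞)⁻¹ := by
    intro m
    obtain ⟨T, hT, hconv⟩ := hω m
    have hε : (0 : ℝ≥0∞) < (m : ℝ≥0∞)⁻¹ := ENNReal.inv_pos.2 (ENNReal.natCast_ne_top m)
    obtain ⟨n, hn, hn'⟩ := ((hT.eventually_ge_atTop (m : ℝ)).and
      (ENNReal.tendsto_nhds_zero.1 (hconv (K' m) (hK'O m) (hK'c m)) _ hε)).exists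
    exact ⟨T n, hn, hn'⟩
  choose τ hτge hτb using hchoice
  have hτ0 : ∀ m, 0 ≤ τ m := fun m ↦ (Nat.cast_nonneg m).trans (hτge m)
  have hτtop : Tendsto τ atTop atTop := tendsto_atTop_mono hτge tendsto_natCast_atTop_atTop
  -- (3) `Cᵏ` Arzelà–Ascoli for the translates `h (· + τ m • e)` (eventual bounds by tameness)
  have hOe' : ∀ x ∈ O, ∀ s : ℝ, 0 ≤ s → x + s • e ∈ O := fun x hx s _ ↦ hOe x hx s
  have hbnd : ∀ K ⊆ O, IsCompact K → ∃ Λ : ℝ, ∀ᶠ n in atTop, ∀ i, i ≤ k + 1 → ∀ z ∈ K,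
      ‖iteratedFDeriv ℝ i h (z + τ n • e)‖ ≤ Λ := by
    intro K hKO' hK
    obtain ⟨Λ, a, hΛ⟩ := htame K hKO' hK
    refine ⟨Λ, ?_⟩
    filter_upwards [hτtop.eventually_ge_atTop a] with n hn
    exact hΛ (τ n) hn
  obtain ⟨g, φ, hφ, hgk, hlim⟩ :=
    exists_strictMono_tendsto_supCkENorm_translate_sub hO hOe' hh hτ0 hbnd
  refine ⟨g, φ, hφ, hgk, ⟨fun n ↦ τ (φ n), hτtop.comp hφ.tendsto_atTop, hlim⟩, ?_⟩
  -- (4) `gs (φ m) → g` in `Cᵏ_loc`: triangle inequality through the translate `h (· + τ (φ m) • e)`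
  intro K hKO' hK
  have hk1 : (k : WithTop ℕ∞) ≤ k + 1 := by exact_mod_cast Nat.le_succ k
  have htr : ∀ s : ℝ, ∀ x ∈ K, ContDiffAt ℝ k (fun y ↦ h (y + s • e)) x := by
    intro s x hx
    have h1 : ContDiffOn ℝ (k + 1) (fun y ↦ h (y + s • e)) O :=
      hh.comp (contDiff_id.add contDiff_const).contDiffOn fun y hy ↦ hOe y hy s
    exact (h1.of_le hk1).contDiffAt (hO.mem_nhds (hKO' hx))
  have hbound : ∀ᶠ m in atTop, supCkENorm K k (fun x ↦ gs (φ m) x - g x) ≤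
      ((φ m : ℕ) : ℝ≥0∞)⁻¹ + supCkENorm K k (fun x ↦ h (x + τ (φ m) • e) - g x) := by
    filter_upwards [hK'cov K hKO' hK] with m hm
    have hmφ : K ⊆ K' (φ m) := hm.trans (accumulate_subset_accumulate hφ.le_apply)
    have heq : (fun x ↦ gs (φ m) x - g x) = (fun x ↦ gs (φ m) x - h (x + τ (φ m) • e)) +
        fun x ↦ h (x + τ (φ m) • e) - g x := by
      funext x
      simp only [Pi.add_apply, sub_add_sub_cancel]
    have hf : ∀ x ∈ K, ContDiffAt ℝ k (fun x ↦ gs (φ m) x - h (x + τ (φ m) • e)) x :=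
      fun x hx ↦ ((hgs (φ m)).contDiffAt (hO.mem_nhds (hKO' hx))).sub (htr (τ (φ m)) x hx)
    have hg : ∀ x ∈ K, ContDiffAt ℝ k (fun x ↦ h (x + τ (φ m) • e) - g x) x :=
      fun x hx ↦ (htr (τ (φ m)) x hx).sub (hgk.contDiffAt (hO.mem_nhds (hKO' hx)))
    rw [heq]
    refine (supCkENorm_add_le hf hg).trans (add_le_add ?_ le_rfl)
    rw [supCkENorm_sub_comm K k (gs (φ m))]
    exact (supCkENorm_mono hmφ k _).trans (hτb (φ m))
  have hlim0 : Tendsto (fun m ↦ ((φ m : ℕ) : ℝ≥0∞)⁻¹ +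
      supCkENorm K k (fun x ↦ h (x + τ (φ m) • e) - g x)) atTop (𝓝 0) := by
    have h0 := (ENNReal.tendsto_inv_nat_nhds_zero.comp hφ.tendsto_atTop).add (hlim K hKO' hK)
    rw [add_zero] at h0
    exact h0
  exact tendsto_of_tendsto_of_tendsto_of_le_of_le' tendsto_const_nhds hlim0
    (Eventually.of_forall fun _ ↦ zero_le) hbound

end Summit.FinalStateConjecture.FinalStateConjecture.Theorems.ClusterCompleteness

end
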